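import Summits.Ventures.LatticeQCDFlow.Scoring.SampleACFSumZero

/-!
# Seeds are replicas of one arm: 'half the seed range' never under-covers the between-seed standard error

HONEST FRAMING: exact (Metropolis-corrected) sampling algorithms for lattice gauge theory;
figures of merit are autocorrelation/cost numbers at stated couplings and volumes; no
continuum-physics claim.

Venture `LatticeQCDFlow` (cell pub-lqcd), sub-topic `Scoring`; FANOUT row 11 (`eng-scorerA`,
fitness scorer A).  NEW WORK of the cell (finite sums; a finite-sample Popoviciu inequality with our
own proof); nothing is cited as a tree fact.

## The rule this file types

LEAD RO-23 (5) (INBOX 2026-08-21T12:52:30Z; F34-2 / board docket §7 `replica {seed, k, n,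
combination}`, combination `mean-seeds`): rows of ONE config hash at ONE key that differ only by
training seed are replicas of one arm; absent a pre-registered rule the default binds — the arm's
value is the UNWEIGHTED MEAN over the `n` boarded VALID seeds and its error is
`max(statistical error, HALF THE SEED RANGE)`.

With seeds `a₀ … a_{n−1}` (any reals), `ā` their mean, `s² = Σ (aᵢ − ā)²/(n − 1)` the between-seed
sample variance and `SE² = s²/n` the squared standard error of the seed mean:

* `sum_dev_sq_le_sum_sq_sub` (König–Huygens) — `Σ (aᵢ − ā)² ≤ Σ (aᵢ − c)²` for every centre `c`;
* `sum_dev_sq_le_bracket` (finite Popoviciu) — if `m ≤ aᵢ ≤ M` for all seeds then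
  `Σ (aᵢ − ā)² ≤ n ((M − m)/2)²`;
* `seedStdErrSq_le_div`, `seedStdErrSq_le` — hence for `n ≥ 2`:
  **`SE² ≤ ((M − m)/2)² / (n − 1) ≤ ((M − m)/2)²`**, i.e. with the tightest bracket (`m = min`,
  `M = max`) **the half-range is at least the between-seed standard error, at every `n ≥ 2`** — the
  default error of RO-23 (5) can over-cover seed scatter (by a factor `≥ √(n−1)` in SE units) but
  never under-cover it; `sqrt_seedStdErrSq_le` is the same in standard-deviation units;
* `seedStdErrSq_two` — `n = 2` is the tight case: two seeds at the bracket ends give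
  `SE² = ((M − m)/2)²` exactly (half-range = standard error), which is why the rule reads naturally on
  the S0-C rows of the day (seeds 2 and 3 of one recipe, LEADERBOARD l.45 / l.51).

What is NOT here: any distributional statement (coverage probability of `ā ± half-range` needs a
model for the seed-to-seed law; with `n = 2–3` seeds none is claimed), and the `statistical` member
of the max (the frozen scorers' Γ / jackknife errors, typed elsewhere in `Scoring/`).
-/

namespace Summit.Ventures.LatticeQCDFlow.Scoring

open Finset
open scoped BigOperators

/-! ### König–Huygens and the finite Popoviciu inequality -/

/-- **König–Huygens.**  The sample mean minimises the sum of squared deviations: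
`Σ_{i<n} (aᵢ − ā)² ≤ Σ_{i<n} (aᵢ − c)²` for every `c` (the difference is `n (ā − c)²`). -/
theorem sum_dev_sq_le_sum_sq_sub (a : ℕ → ℝ) {n : ℕ} (hn : n ≠ 0) (c : ℝ) :
    ∑ i ∈ range n, dev a n i ^ 2 ≤ ∑ i ∈ range n, (a i - c) ^ 2 := by
  have h0 := sum_dev_eq_zero a hn
  have hexp : ∀ i ∈ range n,
      (a i - c) ^ 2 = dev a n i ^ 2 + 2 * (sampleMean a n - c) * dev a n i
        + (sampleMean a n - c) ^ 2 := by
    intro i _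
    unfold dev
    ring
  rw [Finset.sum_congr rfl hexp, Finset.sum_add_distrib, Finset.sum_add_distrib,
    ← Finset.mul_sum, h0, mul_zero, add_zero, Finset.sum_const, Finset.card_range]
  have : 0 ≤ n • (sampleMean a n - c) ^ 2 := nsmul_nonneg (sq_nonneg _) n
  linarith

/-- **Finite Popoviciu.**  Seeds inside a bracket `m ≤ aᵢ ≤ M` have
`Σ_{i<n} (aᵢ − ā)² ≤ n ((M − m)/2)²` (centre the bracket: each `|aᵢ − (m+M)/2| ≤ (M − m)/2`). -/
theorem sum_dev_sq_le_bracket (a : ℕ → ℝ) {n : ℕ} (hn : n ≠ 0) {m M : ℝ}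
    (hm : ∀ i < n, m ≤ a i) (hM : ∀ i < n, a i ≤ M) :
    ∑ i ∈ range n, dev a n i ^ 2 ≤ n * ((M - m) / 2) ^ 2 := by
  refine (sum_dev_sq_le_sum_sq_sub a hn ((m + M) / 2)).trans ?_
  have hterm : ∀ i ∈ range n, (a i - (m + M) / 2) ^ 2 ≤ ((M - m) / 2) ^ 2 := by
    intro i hi
    have hi' := mem_range.mp hi
    have h1 := hm i hi'
    have h2 := hM i hi'
    nlinarith
  calc ∑ i ∈ range n, (a i - (m + M) / 2) ^ 2 ≤ ∑ _i ∈ range n, ((M - m) / 2) ^ 2 :=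
        Finset.sum_le_sum hterm
    _ = n * ((M - m) / 2) ^ 2 := by rw [Finset.sum_const, Finset.card_range, nsmul_eq_mul]

/-! ### The between-seed standard error versus half the range -/

/-- The between-seed sample variance `s² = Σ_{i<n} (aᵢ − ā)² / (n − 1)` (unbiased convention;
`n = 1` gives the junk value `x/0 = 0`). -/
noncomputable def seedVar (a : ℕ → ℝ) (n : ℕ) : ℝ :=
  (∑ i ∈ range n, dev a n i ^ 2) / ((n : ℝ) - 1)

/-- The squared standard error of the seed mean, `SE² = s²/n`. -/
noncomputable def seedStdErrSq (a : ℕ → ℝ) (n : ℕ) : ℝ :=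
  seedVar a n / n

/-- `SE² ≥ 0`. -/
theorem seedStdErrSq_nonneg (a : ℕ → ℝ) {n : ℕ} (hn : 2 ≤ n) : 0 ≤ seedStdErrSq a n := by
  unfold seedStdErrSq seedVar
  have h1 : (0 : ℝ) < (n : ℝ) - 1 := by
    have : (2 : ℝ) ≤ n := by exact_mod_cast hn
    linarith
  have h2 : (0 : ℝ) < n := by
    have : (2 : ℝ) ≤ n := by exact_mod_cast hn
    linarith
  exact div_nonneg (div_nonneg (Finset.sum_nonneg fun i _ => sq_nonneg _) h1.le) h2.le

/-- **`SE² ≤ ((M − m)/2)² / (n − 1)`** for `n ≥ 2` seeds inside the bracket `[m, M]`. -/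
theorem seedStdErrSq_le_div (a : ℕ → ℝ) {n : ℕ} (hn : 2 ≤ n) {m M : ℝ}
    (hm : ∀ i < n, m ≤ a i) (hM : ∀ i < n, a i ≤ M) :
    seedStdErrSq a n ≤ ((M - m) / 2) ^ 2 / ((n : ℝ) - 1) := by
  have hn0 : n ≠ 0 := by omega
  have hn' : (2 : ℝ) ≤ n := by exact_mod_cast hn
  have h1 : (0 : ℝ) < (n : ℝ) - 1 := by linarith
  have h2 : (0 : ℝ) < n := by linarith
  have hP := sum_dev_sq_le_bracket a hn0 hm hM
  unfold seedStdErrSq seedVar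
  rw [div_div, div_le_div_iff₀ (mul_pos h1 h2) h1]
  calc (∑ i ∈ range n, dev a n i ^ 2) * ((n : ℝ) - 1)
      ≤ (n * ((M - m) / 2) ^ 2) * ((n : ℝ) - 1) := mul_le_mul_of_nonneg_right hP h1.le
    _ = ((M - m) / 2) ^ 2 * (((n : ℝ) - 1) * n) := by ring

/-- **Half the bracket is at least the between-seed standard error:** `SE² ≤ ((M − m)/2)²` for every
`n ≥ 2` — with `m = min`, `M = max` of the seeds this is RO-23 (5)'s 'half the seed range'. -/
theorem seedStdErrSq_le (a : ℕ → ℝ) {n : ℕ} (hn : 2 ≤ n) {m M : ℝ}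
    (hm : ∀ i < n, m ≤ a i) (hM : ∀ i < n, a i ≤ M) :
    seedStdErrSq a n ≤ ((M - m) / 2) ^ 2 := by
  refine (seedStdErrSq_le_div a hn hm hM).trans ?_
  have hn' : (2 : ℝ) ≤ n := by exact_mod_cast hn
  have h1 : (1 : ℝ) ≤ (n : ℝ) - 1 := by linarith
  exact div_le_self (sq_nonneg _) h1

/-- The same in standard-deviation units: `SE ≤ (M − m)/2` (`m ≤ M` is implied by `n ≥ 2` seeds in
the bracket, but we take it as a hypothesis to keep the statement local). -/
theorem sqrt_seedStdErrSq_le (a : ℕ → ℝ) {n : ℕ} (hn : 2 ≤ n) {m M : ℝ} (hmM : m ≤ M)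
    (hm : ∀ i < n, m ≤ a i) (hM : ∀ i < n, a i ≤ M) :
    Real.sqrt (seedStdErrSq a n) ≤ (M - m) / 2 := by
  have h := seedStdErrSq_le a hn hm hM
  have hhalf : 0 ≤ (M - m) / 2 := by linarith
  calc Real.sqrt (seedStdErrSq a n) ≤ Real.sqrt (((M - m) / 2) ^ 2) := Real.sqrt_le_sqrt h
    _ = (M - m) / 2 := Real.sqrt_sq hhalf

/-- **The over-covering factor.**  In SE units the half-bracket exceeds the standard error by at
least `√(n − 1)`: `(n − 1) · SE² ≤ ((M − m)/2)²`. -/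
theorem sub_one_mul_seedStdErrSq_le (a : ℕ → ℝ) {n : ℕ} (hn : 2 ≤ n) {m M : ℝ}
    (hm : ∀ i < n, m ≤ a i) (hM : ∀ i < n, a i ≤ M) :
    ((n : ℝ) - 1) * seedStdErrSq a n ≤ ((M - m) / 2) ^ 2 := by
  have hn' : (2 : ℝ) ≤ n := by exact_mod_cast hn
  have h1 : (0 : ℝ) < (n : ℝ) - 1 := by linarith
  have h := seedStdErrSq_le_div a hn hm hM
  rwa [le_div_iff₀ h1, mul_comm] at h

/-! ### `n = 2`: half-range IS the standard error -/

/-- Two seeds: `ā = (a₀ + a₁)/2`. -/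
theorem sampleMean_two (a : ℕ → ℝ) : sampleMean a 2 = (a 0 + a 1) / 2 := by
  unfold sampleMean
  simp [Finset.sum_range_succ]

/-- **Tightness at `n = 2`.**  `SE² = ((a₁ − a₀)/2)²` exactly — for two seeds the between-seed
standard error of the mean equals half their distance, so 'half the seed range' and the replica
standard error coincide (the day's S0-C rows: two seeds of one recipe per key). -/
theorem seedStdErrSq_two (a : ℕ → ℝ) : seedStdErrSq a 2 = ((a 1 - a 0) / 2) ^ 2 := by
  unfold seedStdErrSq seedVar dev
  rw [sampleMean_two]
  simp [Finset.sum_range_succ]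
  ring

/-- Worked instance: two seeds reading `2/5` and `9/20` (the shape of the day's S0-C pair, whose
acceptances were 0.405 / 0.450) ⇒ `SE² = (1/40)² = 1/1600` and half-range `1/40` — equal, as
`seedStdErrSq_two` says. -/
theorem seedStdErrSq_example :
    seedStdErrSq (fun i => if i = 0 then (2 / 5 : ℝ) else 9 / 20) 2 = 1 / 1600 := by
  rw [seedStdErrSq_two]
  norm_num

end Summit.Ventures.LatticeQCDFlow.Scoring
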